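import Mathlib.Data.ENat.Lattice
import Summits.BirchSwinnertonDyer.BirchSwinnertonDyer.Theorems.Rank1ResidualJetSection6
import Summits.BirchSwinnertonDyer.BirchSwinnertonDyer.Theorems.ClassRecordThreeEulerHalvesAtThreeLozenge
import HarnessLib

/-!
# Jetchev 2008 Prop. 6.4 «core vertices exist» as a KERNEL THEOREM over abstract Selmer data, by a
# potential argument; and §6's deduction of Thm. 1.4 re-composed with it (cell `bsd-stepL`, seat
# `bsd-stepL-tam3-p1`, helper toward item 19109 `EulerHalvesAtThree`, stub `stub_jetchevMaxHLAtThree`)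

HONEST FRAMING. Nothing here proves BSD, J₃ (in any form) or the divisibility of any Heegner point of
any curve; the registered stub `stub_jetchevMaxHLAtThree` (Jetchev 2008 Thm. 1.4 READ at `p = 3 ∥ N`)
is NOT discharged; no item closes; 0 classes move (T7); `--supports stmt-BirchSwinnertonDyer-19109`
(helper). WHAT MOVES: in the kernel line of that stub (= the (J∥) line S1–S10 of `bsd-jet`'s sheet
`PV2-J6-KERNEL.md`, whose carrier-blind half is `Theorems/Rank1ResidualJetSection6.lean`, p471669) the
brick S8 = D. Jetchev, Compos. Math. **144** (2008), Prop. 6.4 (p. 824: «Let `c ∈ Λ` satisfy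
`m(c) + m ≤ M(c)`. There exists a core vertex `c' ∈ Λ_{m+m(c)}` such that `m(c') ≤ m(c)`»), until now
the HYPOTHESIS `h64` of `JET.Section6.tamagawaExponent_le_mInfty_of_coreVertices` and graded «FACT, M,
days — finite abelian p-group invariant theory (Mazur–Rubin 2004 §4.1 ∕ Howard 2004 §1.6)», becomes a
THEOREM over abstract data of the same kind as p471669's (finite abelian groups, subgroups,
localisation homomorphisms, orders of elements), with hypotheses ONE FOR ONE the outputs of the
printed inputs §3.1 items 4–7, Prop. 4.7, Thm. 5.1 + Lemma 5.2 (iii) (as one number per prime and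
sign), Lemma 6.1 (= McCallum 1991 Cor. 3.2) — and NO input about invariants, no Cassels–Tate ∕ Flach
pairing, no structure theorem of Kolyvagin. The instantiation layer (S1 signs on `H¹(K, E[p^m])`, S2
the structures `𝓕(c)`, `𝓕^ℓ(c)`, S4 Lemma 6.1 at level `p^m`, S7, S10) is NOT here and not claimed.

## The observation (why the printed proof can be bypassed)
p471669's kernel Thm. 6.3 (`tamagawaExponent_le_mInfty_of_minimalCoreVertex`) uses of «`c` is a core
vertex» only `hcore : 𝓗_{𝓕(c)}^{−ε(c)} = 0`; on the `ε(c)` side it needs `κ̃_{c,m}` of order `p^m` and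
nothing about `𝓗_{𝓕(c)}^{ε(c)} ≅ ℤ/p^m` (sheet PV2-J6-KERNEL §3 (v)). Call such `c` a HALF-core vertex.
Walk `c ↦ cℓ₁ ↦ cℓ₁ℓ₂ ↦ …` choosing `ℓ` by Lemma 6.1 for the pair (`κ̃` on the `ε` side, any `y ≠ 0` on
the `−ε` side). By `lozenge_epsSide` (the `ε(c)`-module at `cℓ` is the strict one, of index `p^m` in
`𝓗_{𝓕(c)}^{ε}`) and `lozenge_negSide` (the `−ε(c)`-module at `cℓ` has
`# ≤ p^m · #𝓗_{𝓕(c)}^{−ε} / ord(y)²`), and `ε(cℓ) = −ε(c)`, the potential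
`Φ(c) = #𝓗_{𝓕(c)}^{+} · #𝓗_{𝓕(c)}^{−}` satisfies `Φ(cℓ) · ord(y)² ≤ Φ(c)`, so it drops strictly while
the `−ε` side is non-zero; and `m(cℓ) ≤ m(c)` by Prop. 4.7 exactly as in print
(`p^{m−m(c)} = ord loc_λ κ_{c} = ord loc_λ κ_{cℓ} ∣ ord κ_{cℓ}`), which also keeps `κ̃_{cℓ}` of order
`p^m` available. Induction on `Φ` ends at a half-core vertex `c'` with `m(c') ≤ m(c)`.

## Dictionary for `exists_halfCoreVertex` (fixed level `p^k`, base conductor `c`)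
`P ↦` the Kolyvagin primes `ℓ ∈ Λ¹` prime to `c` with `M(ℓ) ≥ k + m(c)` (so `M(c·n) ≥ k + m(c)` for every
square-free product `n`, hypothesis `hM`); conductors `c·n`, `n : Finset P`; `G ↦ H¹(K, E[p^k])`,
`Gs s ↦ H¹(K, E[p^k])^{s}`; `loc ℓ ↦ loc_λ`; `Hf ℓ s ∕ Htr ℓ s ↦ H¹_f(K_λ)^s ∕ H¹_tr(K_λ)^s` (disjoint);
`Sel n s ↦ 𝓗_{𝓕(cn)}^s ≤ Gs s`; `Rel n ℓ s ↦ 𝓗_{𝓕^ℓ(cn)}^s` (finite) with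
`hSel ∕ hSelT ↦ 𝓕(cn) = 𝓕^ℓ(cn) + (finite at λ)`, `𝓕(cnℓ) = 𝓕^ℓ(cn) + (transverse at λ)` ([J] §4.3);
`hPT ↦ #loc_λ(𝓗_{𝓕^ℓ(cn)}^s) = p^k` (Thm. 5.1 for `𝓕_ℓ(cn) ≼ 𝓕^ℓ(cn)`, self-dual Kummer structure, per
sign = Lemma 5.2 (iii)); `e n ↦ ε(cn)`, `he ↦ ε(cnℓ) = −ε(cn)` (§3.1 item 6); `h61 ↦` Lemma 6.1 for a
pair (class on the `s` side, non-zero class on the `−s` side), `ℓ` avoiding `n` (McCallum Cor. 3.2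
gives infinitely many); `M n ∕ mdiv n ∕ mc n ↦ M(cn) ∕ m'(cn) ∕ m(cn)` (ℕ∞-valued, `⊤` = ∞) with
`hm ↦` §3.1 item 5 in the convention-insensitive form of `depth_le_mdiv_of_le_mInfty`;
`κ n ∕ κt n ↦ κ_{cn,k} ∕ κ̃_{cn,k}` with `hκt ↦` §3.1 item 7 and `hordκ ↦` items 4–5 + the injectivity of
`E(K[cn])/p^k ↪ H¹` (`ord κ_{cn,k} = p^{k − m'(cn)}` if `m'(cn) ≤ k`, trivial class otherwise — stated as:
`p^{k−j} ∣ ord κ_{cn,k}`, `j < k` ⟹ `m'(cn) ≤ j`); `h47 ↦` Prop. 4.7. CONCLUSION: `∃ n`,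
`𝓗_{𝓕(cn)}^{−ε(cn)} = 0 ∧ m(cn) ≤ m(c)`.
§4 re-composes p471669's «Proof of Theorem 1.4» with Prop. 6.4 asked only where the walk applies
(`m(c) < k`, which is the printed situation `k = m > m_∞ = m(c)`):
`tamagawaExponent_le_mInfty_of_halfCoreVertices`, `depth_le_mdiv_of_halfCoreVertices`.
References (locators only, no cited FACT declared): [cite: Jetchev2008, §3.1 (p. 817), Prop. 4.7
(p. 820), Thm. 5.1, Lemma 5.2 (pp. 821–822), Lemma 6.1, §6.2, Prop. 6.4 and Proof of Thm. 1.4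
(pp. 822–825)] [cite: McCallumLMS1991, §3 Cor. 3.2 (p. 299), §5 Prop. 5.2 (p. 304)].
Design: no definitions; `Type*`-polymorphic; `Nat.card`; ENat for `M, m', m`; hypotheses stated for
all `n : Finset P` (the instantiation has them uniformly in the conductor). Axioms: `propext`,
`Classical.choice`, `Quot.sound`.
-/

set_option autoImplicit false

noncomputable section

open scoped Classical

namespace Summit.BirchSwinnertonDyer.Rank1Residual.JET.Section6

/-! ### §3 [J] Prop. 6.4 — abstract: HALF-core vertices exist, by the potential `#𝓗^ε · #𝓗^{−ε}` -/

section Walk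

variable {G : Type*} [AddCommGroup G] {P : Type*} [DecidableEq P]
  {L : P → Type*} [∀ ℓ, AddCommGroup (L ℓ)]

/-- One step of the walk `c·n ↦ c·n·ℓ` (both signs together). Data as in `exists_halfCoreVertex`.
Given `n` with `m(cn) ≤ m(c)`, finite Selmer modules at `cn`, and `𝓗_{𝓕(cn)}^{−ε(cn)} ≠ 0`, there is
`ℓ ∉ n` with: `m(cnℓ) ≤ m(cn)`, finite Selmer modules at `cnℓ`, and
`#𝓗_{𝓕(cnℓ)}^{ε(cnℓ)} · #𝓗_{𝓕(cnℓ)}^{−ε(cnℓ)} < #𝓗_{𝓕(cn)}^{ε(cn)} · #𝓗_{𝓕(cn)}^{−ε(cn)}`. -/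
theorem halfCoreVertex_step
    {p k : ℕ} (hp : p.Prime)
    (loc : ∀ ℓ : P, G →+ L ℓ) (Hf Htr : ∀ ℓ : P, Bool → AddSubgroup (L ℓ))
    (hdisj : ∀ ℓ s, Disjoint (Hf ℓ s) (Htr ℓ s))
    (Gs : Bool → AddSubgroup G) (Sel : Finset P → Bool → AddSubgroup G)
    (Rel : Finset P → P → Bool → AddSubgroup G) (hSelGs : ∀ n s, Sel n s ≤ Gs s)
    (hfin : ∀ n ℓ s, ℓ ∉ n → Finite (Rel n ℓ s))
    (hSel : ∀ n ℓ s, ℓ ∉ n → Sel n s = Rel n ℓ s ⊓ (Hf ℓ s).comap (loc ℓ))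
    (hSelT : ∀ n ℓ s, ℓ ∉ n → Sel (insert ℓ n) s = Rel n ℓ s ⊓ (Htr ℓ s).comap (loc ℓ))
    (hPT : ∀ n ℓ s, ℓ ∉ n → Nat.card ((Rel n ℓ s).map (loc ℓ)) = p ^ k)
    (e : Finset P → Bool) (he : ∀ n ℓ, ℓ ∉ n → e (insert ℓ n) = !e n)
    (h61 : ∀ (s : Bool) (x y : G), x ∈ Gs s → y ∈ Gs (!s) → y ≠ 0 → ∀ n : Finset P,
      ∃ ℓ, ℓ ∉ n ∧ addOrderOf (loc ℓ x) = addOrderOf x ∧ addOrderOf (loc ℓ y) = addOrderOf y)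
    (M mdiv mc : Finset P → ℕ∞) (hm : ∀ n, mdiv n < M n → mc n ≤ mdiv n)
    (hM : ∀ n, (k : ℕ∞) + mc ∅ ≤ M n)
    (κ κt : Finset P → G)
    (hκt : ∀ n, mc n + k ≤ M n →
      κt n ∈ Sel n (e n) ∧ addOrderOf (κt n) = p ^ k ∧ κ n = p ^ (mc n).toNat • κt n)
    (hordκ : ∀ n (j : ℕ), j < k → p ^ (k - j) ∣ addOrderOf (κ n) → mdiv n ≤ j)
    (h47 : ∀ n ℓ, ℓ ∉ n → addOrderOf (loc ℓ (κ (insert ℓ n))) = addOrderOf (loc ℓ (κ n)))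
    (h0 : mc ∅ < k)
    (n : Finset P) (hn : mc n ≤ mc ∅) (hfinSel : ∀ s, Finite (Sel n s))
    (hne : Sel n (!e n) ≠ ⊥) :
    ∃ ℓ, ℓ ∉ n ∧ mc (insert ℓ n) ≤ mc n ∧ (∀ s, Finite (Sel (insert ℓ n) s)) ∧
      Nat.card (Sel (insert ℓ n) (e (insert ℓ n))) * Nat.card (Sel (insert ℓ n) (!e (insert ℓ n)))
        < Nat.card (Sel n (e n)) * Nat.card (Sel n (!e n)) := by
  -- bookkeeping in `ℕ∞`: `mc n` is finite, `< k`, and `mc n + k ≤ M n'` for every `n'`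
  have hk0 : 0 < k := by
    have : (mc ∅ : ℕ∞) < k := h0
    exact Nat.pos_of_ne_zero (by rintro rfl; simp at this)
  have hmcn_lt : mc n < (k : ℕ∞) := lt_of_le_of_lt hn h0
  have hmcn_ne : mc n ≠ ⊤ := ne_top_of_lt hmcn_lt
  set t : ℕ := (mc n).toNat with ht
  have hmct : mc n = (t : ℕ∞) := (ENat.coe_toNat hmcn_ne).symm
  have htk : t < k := by
    have : ((t : ℕ) : ℕ∞) < (k : ℕ∞) := hmct ▸ hmcn_lt
    exact_mod_cast this
  have hMn : ∀ n', mc n + k ≤ M n' := fun n' =>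
    calc mc n + (k : ℕ∞) ≤ mc ∅ + k := add_le_add hn le_rfl
      _ = (k : ℕ∞) + mc ∅ := add_comm _ _
      _ ≤ M n' := hM n'
  -- the class `κ̃` at `cn`
  obtain ⟨hκtSel, hκtord, hκeq⟩ := hκt n (hMn n)
  -- a non-zero class on the `−ε(cn)` side
  obtain ⟨y, hySel, hy0⟩ : ∃ y ∈ Sel n (!e n), y ≠ 0 := by
    rcases (Sel n (!e n)).bot_or_exists_ne_zero with h | ⟨y, hy, hy0⟩
    · exact (hne h).elim
    · exact ⟨y, hy, hy0⟩
  -- Lemma 6.1: choose `ℓ ∉ n`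
  obtain ⟨ℓ, hℓn, hℓx, hℓy⟩ :=
    h61 (e n) (κt n) y (hSelGs _ _ hκtSel) (hSelGs _ _ hySel) hy0 n
  rw [hκtord] at hℓx
  haveI : ∀ s, Finite (Rel n ℓ s) := fun s => hfin n ℓ s hℓn
  haveI : ∀ s, Finite ((Rel n ℓ s).map (loc ℓ)) := fun s => finite_map_of_finite (loc ℓ) _
  -- ε-side: `Sel n (e n) = Rel`, `Sel n⁺ (e n) = Rel ⊓ ker`, `#Sel n (e n) = #Sel n⁺ (e n) · p^k`
  have hxRel : κt n ∈ Rel n ℓ (e n) := by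
    have := hκtSel; rw [hSel n ℓ (e n) hℓn] at this; exact this.1
  have hxf : loc ℓ (κt n) ∈ Hf ℓ (e n) := by
    have := hκtSel; rw [hSel n ℓ (e n) hℓn] at this; exact this.2
  obtain ⟨hA1, hA2, hA3⟩ := lozenge_epsSide (loc ℓ) (Rel n ℓ (e n)) (Hf ℓ (e n)) (Htr ℓ (e n))
    (hdisj ℓ (e n)) hxRel hxf (by rw [hPT n ℓ (e n) hℓn, hℓx])
  have hSel_e : Sel n (e n) = Rel n ℓ (e n) := by rw [hSel n ℓ (e n) hℓn, hA1]
  have hSelT_e : Sel (insert ℓ n) (e n) = Rel n ℓ (e n) ⊓ (loc ℓ).ker := by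
    rw [hSelT n ℓ (e n) hℓn, hA2]
  have hcard_e : Nat.card (Sel n (e n)) = Nat.card (Sel (insert ℓ n) (e n)) * p ^ k := by
    rw [hSel_e, hSelT_e, hA3, hℓx]
  -- −ε-side: `#Sel n⁺ (!e n) · ord(y)² ≤ p^k · #Sel n (!e n)`
  have hyRel : y ∈ Rel n ℓ (!e n) := by
    have := hySel; rw [hSel n ℓ (!e n) hℓn] at this; exact this.1
  have hyf : loc ℓ y ∈ Hf ℓ (!e n) := by
    have := hySel; rw [hSel n ℓ (!e n) hℓn] at this; exact this.2
  have hB := lozenge_negSide (loc ℓ) (Rel n ℓ (!e n)) (Hf ℓ (!e n)) (Htr ℓ (!e n))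
    (hdisj ℓ (!e n)) hyRel hyf
  rw [hPT n ℓ (!e n) hℓn, hℓy, ← hSel n ℓ (!e n) hℓn, ← hSelT n ℓ (!e n) hℓn] at hB
  -- `ord y ≥ 2`
  have hordy : 2 ≤ addOrderOf y := by
    haveI := hfinSel (!e n)
    have hdvd : addOrderOf y ∣ Nat.card (Sel n (!e n)) :=
      (Sel n (!e n)).addOrderOf_dvd_natCard hySel
    have hcpos : 0 < Nat.card (Sel n (!e n)) := Nat.card_pos
    have hpos : 0 < addOrderOf y := Nat.pos_of_dvd_of_pos hdvd hcpos
    have hne1 : addOrderOf y ≠ 1 := by rwa [Ne, AddMonoid.addOrderOf_eq_one_iff]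
    omega
  -- finiteness at `n⁺`
  have hfinT : ∀ s, Finite (Sel (insert ℓ n) s) := by
    intro s; rw [hSelT n ℓ s hℓn]; exact finite_of_le' inf_le_left
  -- `m(cnℓ) ≤ m(cn)` (Prop. 4.7 + §3.1 bookkeeping)
  have hmc : mc (insert ℓ n) ≤ mc n := by
    have hordκn : addOrderOf (loc ℓ (κ n)) = p ^ (k - t) := by
      rw [hκeq, map_nsmul]
      exact addOrderOf_pow_nsmul_eq hp htk.le _ hℓx
    have hdvd : p ^ (k - t) ∣ addOrderOf (κ (insert ℓ n)) := by
      rw [← hordκn, ← h47 n ℓ hℓn]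
      exact addOrderOf_map_dvd (loc ℓ) _
    have h1 : mdiv (insert ℓ n) ≤ (t : ℕ∞) := hordκ _ t htk hdvd
    have h2 : mdiv (insert ℓ n) < M (insert ℓ n) := by
      calc mdiv (insert ℓ n) ≤ (t : ℕ∞) := h1
        _ = mc n := hmct.symm
        _ < mc n + k := by
            rw [hmct]
            exact_mod_cast Nat.lt_add_of_pos_right hk0
        _ ≤ M (insert ℓ n) := hMn _
    calc mc (insert ℓ n) ≤ mdiv (insert ℓ n) := hm _ h2
      _ ≤ (t : ℕ∞) := h1
      _ = mc n := hmct.symm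
  -- the potential drops
  refine ⟨ℓ, hℓn, hmc, hfinT, ?_⟩
  have he' : e (insert ℓ n) = !e n := he n ℓ hℓn
  rw [he', Bool.not_not, hcard_e]
  haveI := hfinT (e n)
  haveI := hfinT (!e n)
  have hpos1 : 0 < Nat.card (Sel (insert ℓ n) (e n)) := Nat.card_pos
  have hpos2 : 0 < Nat.card (Sel (insert ℓ n) (!e n)) := Nat.card_pos
  -- `#T(!e) * ord(y)^2 ≤ p^k * #Sel n (!e n)` with `ord y ≥ 2`
  have h4 : Nat.card (Sel (insert ℓ n) (!e n)) * 4 ≤ p ^ k * Nat.card (Sel n (!e n)) :=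
    le_trans (Nat.mul_le_mul_left _ (by nlinarith [hordy])) hB
  nlinarith [h4, hpos1, hpos2]

/-- **Jetchev 2008, Prop. 6.4 (p. 824), abstract kernel form — HALF-core vertices exist.**
Fix a level `p^k`, a conductor `c` with `m(c) < k` and `m(c) + k ≤ M(c·n)` for every square-free
product `n` of the available Kolyvagin primes `P` (those `ℓ ∈ Λ¹` prime to `c` with `M(ℓ) ≥ k + m(c)`).
DATA (dictionary, [J] §§3.1, 4.3, 5, 6): `G ↦ H¹(K, E[p^k])`, `Gs s ↦` its `±`-eigenspaces under
complex conjugation; `loc ℓ ↦ loc_λ`, `Hf ℓ s`, `Htr ℓ s ↦` the `s`-parts of the finite and the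
transverse conditions at `λ ∣ ℓ` (disjoint); `Sel n s ↦ 𝓗_{𝓕(cn)}^s`, `Rel n ℓ s ↦ 𝓗_{𝓕^ℓ(cn)}^s`
(finite), related by `hSel`/`hSelT` (the structures `𝓕(cn)`, `𝓕(cnℓ)` are `𝓕^ℓ(cn)` plus the finite,
resp. transverse, condition at `λ`); `hPT ↦ #loc_λ(𝓗_{𝓕^ℓ(cn)}^s) = p^k` = Thm. 5.1 for
`𝓕_ℓ(cn) ≼ 𝓕^ℓ(cn)` with the self-duality of the Kummer structure (Lemma 5.2 (iii), `a + a^* = m`, per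
sign); `e n ↦ ε(cn)` with `ε(cnℓ) = −ε(cn)` (§3.1 item 6); `h61 ↦` Lemma 6.1 (= McCallum 1991 Cor. 3.2:
infinitely many `ℓ`, so `ℓ ∉ n` may be imposed); `M n ↦ M(cn)`, `mdiv n ↦ m'(cn)`, `mc n ↦ m(cn)` with
`hm ↦` §3.1 item 5 (in the convention-insensitive form of `depth_le_mdiv_of_le_mInfty`), `hM ↦` the
choice of `P`; `κ n ↦ κ_{cn,k}`, `κt n ↦ κ̃_{cn,k}` with `hκt ↦` §3.1 item 7 (`κ̃` defined when
`m(cn) + k ≤ M(cn)`, of order `p^k`, `κ = p^{m(cn)} κ̃`, on the `ε(cn)` side) and `hordκ ↦` §3.1 items 4–5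
with the injectivity of `E(K[cn])/p^k → H¹` (`ord κ_{cn,k} = p^{k − m'(cn)}` when `m'(cn) ≤ k`, else
`κ_{cn,k} = 0`); `h47 ↦` Prop. 4.7 (`loc_λ κ_{cnℓ} = φ_λ(loc_λ κ_{cn})`, `φ_λ` an isomorphism).
CONCLUSION: some `c' = c·n` has `𝓗_{𝓕(c')}^{−ε(c')} = 0` and `m(c') ≤ m(c)` (whence
`m(c') + k ≤ M(c')` and `κ̃_{c',k}` of order `p^k` on the `ε(c')` side: the hypotheses `hcore`, `hκt`
of `tamagawaExponent_le_mInfty_of_minimalCoreVertex`, which never uses `𝓗^{ε(c')} ≅ ℤ/p^k`).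
PROOF (NOT the printed invariant-lowering sketch, whose «`y₁ = y₂`» needs the Cassels–Tate∕Flach pair
structure): as long as `𝓗_{𝓕(cn)}^{−ε} ≠ 0` pick `y ≠ 0` in it and `ℓ` by Lemma 6.1 for
`(κ̃_{cn}, y)`; by `lozenge_epsSide` ∕ `lozenge_negSide` the potential `#𝓗_{𝓕(cn)}^{ε}·#𝓗_{𝓕(cn)}^{−ε}`
drops at `cnℓ` by the factor `ord(y)² ≥ 4`, and `m(cnℓ) ≤ m(cn)` by Prop. 4.7; induction on the
potential. [cite: Jetchev2008, Prop. 6.4 (p. 824); §3.1, Prop. 4.7, Thm. 5.1, Lemma 5.2, Lemma 6.1]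
[cite: McCallumLMS1991, Cor. 3.2 (p. 299)] -/
theorem exists_halfCoreVertex
    {p k : ℕ} (hp : p.Prime)
    (loc : ∀ ℓ : P, G →+ L ℓ) (Hf Htr : ∀ ℓ : P, Bool → AddSubgroup (L ℓ))
    (hdisj : ∀ ℓ s, Disjoint (Hf ℓ s) (Htr ℓ s))
    (Gs : Bool → AddSubgroup G) (Sel : Finset P → Bool → AddSubgroup G)
    (Rel : Finset P → P → Bool → AddSubgroup G) (hSelGs : ∀ n s, Sel n s ≤ Gs s)
    (hfin : ∀ n ℓ s, ℓ ∉ n → Finite (Rel n ℓ s))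
    (hSel : ∀ n ℓ s, ℓ ∉ n → Sel n s = Rel n ℓ s ⊓ (Hf ℓ s).comap (loc ℓ))
    (hSelT : ∀ n ℓ s, ℓ ∉ n → Sel (insert ℓ n) s = Rel n ℓ s ⊓ (Htr ℓ s).comap (loc ℓ))
    (hPT : ∀ n ℓ s, ℓ ∉ n → Nat.card ((Rel n ℓ s).map (loc ℓ)) = p ^ k)
    (e : Finset P → Bool) (he : ∀ n ℓ, ℓ ∉ n → e (insert ℓ n) = !e n)
    (h61 : ∀ (s : Bool) (x y : G), x ∈ Gs s → y ∈ Gs (!s) → y ≠ 0 → ∀ n : Finset P,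
      ∃ ℓ, ℓ ∉ n ∧ addOrderOf (loc ℓ x) = addOrderOf x ∧ addOrderOf (loc ℓ y) = addOrderOf y)
    (M mdiv mc : Finset P → ℕ∞) (hm : ∀ n, mdiv n < M n → mc n ≤ mdiv n)
    (hM : ∀ n, (k : ℕ∞) + mc ∅ ≤ M n)
    (κ κt : Finset P → G)
    (hκt : ∀ n, mc n + k ≤ M n →
      κt n ∈ Sel n (e n) ∧ addOrderOf (κt n) = p ^ k ∧ κ n = p ^ (mc n).toNat • κt n)
    (hordκ : ∀ n (j : ℕ), j < k → p ^ (k - j) ∣ addOrderOf (κ n) → mdiv n ≤ j)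
    (h47 : ∀ n ℓ, ℓ ∉ n → addOrderOf (loc ℓ (κ (insert ℓ n))) = addOrderOf (loc ℓ (κ n)))
    (h0 : mc ∅ < k) :
    ∃ n : Finset P, Sel n (!e n) = ⊥ ∧ mc n ≤ mc ∅ := by
  -- the inductive claim, on the potential, for conductors with finite Selmer modules
  have claim : ∀ (N : ℕ) (n : Finset P), mc n ≤ mc ∅ → (∀ s, Finite (Sel n s)) →
      Nat.card (Sel n (e n)) * Nat.card (Sel n (!e n)) ≤ N →
      ∃ n' : Finset P, Sel n' (!e n') = ⊥ ∧ mc n' ≤ mc ∅ := by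
    intro N
    induction N with
    | zero =>
      intro n _ hfinSel hΦ
      haveI := hfinSel (e n); haveI := hfinSel (!e n)
      have h1 : 0 < Nat.card (Sel n (e n)) := Nat.card_pos
      have h2 : 0 < Nat.card (Sel n (!e n)) := Nat.card_pos
      have : 0 < Nat.card (Sel n (e n)) * Nat.card (Sel n (!e n)) := Nat.mul_pos h1 h2
      omega
    | succ N ih =>
      intro n hn hfinSel hΦ
      by_cases hcore : Sel n (!e n) = ⊥
      · exact ⟨n, hcore, hn⟩
      obtain ⟨ℓ, -, hmc, hfinT, hlt⟩ := halfCoreVertex_step hp loc Hf Htr hdisj Gs Sel Rel hSelGs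
        hfin hSel hSelT hPT e he h61 M mdiv mc hm hM κ κt hκt hordκ h47 h0 n hn hfinSel hcore
      exact ih (insert ℓ n) (hmc.trans hn) hfinT (by omega)
  -- start of the walk: either `c` itself is a half-core vertex, or one step makes everything finite
  by_cases hcore : Sel ∅ (!e ∅) = ⊥
  · exact ⟨∅, hcore, le_rfl⟩
  -- a non-zero `y` and Lemma 6.1 give some `ℓ`, whence finiteness of the Selmer modules at `c`
  obtain ⟨y, hySel, hy0⟩ : ∃ y ∈ Sel ∅ (!e ∅), y ≠ 0 := by
    rcases (Sel ∅ (!e ∅)).bot_or_exists_ne_zero with h | ⟨y, hy, hy0⟩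
    · exact (hcore h).elim
    · exact ⟨y, hy, hy0⟩
  have hM0 : mc ∅ + k ≤ M ∅ := by rw [add_comm]; exact hM ∅
  obtain ⟨hκtSel, -, -⟩ := hκt ∅ hM0
  obtain ⟨ℓ, hℓn, -, -⟩ := h61 (e ∅) (κt ∅) y (hSelGs _ _ hκtSel) (hSelGs _ _ hySel) hy0 ∅
  have hfin0 : ∀ s, Finite (Sel ∅ s) := by
    intro s
    haveI := hfin ∅ ℓ s hℓn
    rw [hSel ∅ ℓ s hℓn]
    exact finite_of_le' inf_le_left
  exact claim _ ∅ le_rfl hfin0 le_rfl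

end Walk

/-! ### §4 Composition with Thm. 6.3 ∕ the proof of Thm. 1.4 (p471669) under the sharpened Prop. 6.4 -/

/-- `tamagawaExponent_le_mInfty_of_coreVertices` (p471669) with Prop. 6.4 asked only at levels
`k > m(c)` — the shape delivered by `exists_halfCoreVertex` (whose walk needs `κ_{c,k} ≠ 0`, i.e.
`m(c) < k`); the printed deduction (p. 825) applies Prop. 6.4 exactly at `k = m > m_∞ = m(c)`.
Here `Core k c'` is any predicate implied by «`𝓗_{𝓕(c')}^{−ε(c')} = 0` at level `p^k`» for which the
Thm-6.3-shaped hypothesis `h63` is available (by `tamagawaExponent_le_mInfty_of_minimalCoreVertex`,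
which uses of the core vertex only `hcore : A' = ⊥`). [cite: Jetchev2008, Proof of Thm. 1.4 (p. 825)] -/
theorem tamagawaExponent_le_mInfty_of_halfCoreVertices
    {Λ : Type*} (M m : Λ → ℕ∞) (Core : ℕ → Λ → Prop) (t mInf : ℕ)
    (hmInf : ∀ c, (mInf : ℕ∞) ≤ m c)
    (hK : ∀ m' : ℕ, ∃ c, (m' : ℕ∞) ≤ M c ∧ m c = mInf)
    (h64 : ∀ (k : ℕ) (c : Λ), m c + k ≤ M c → m c < k →
      ∃ c', Core k c' ∧ (k : ℕ∞) + m c ≤ M c' ∧ m c' ≤ m c)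
    (h63 : ∀ (k : ℕ) (c : Λ), Core k c → m c = mInf → (k : ℕ∞) + mInf ≤ M c →
      t < k → mInf < k → t ≤ mInf) :
    t ≤ mInf := by
  set k : ℕ := max t mInf + 1 with hk
  have htk : t < k := by omega
  have hInfk : mInf < k := by omega
  obtain ⟨c, hMc, hmc⟩ := hK (k + mInf)
  have hck : m c + k ≤ M c := by
    rw [hmc]
    calc (mInf : ℕ∞) + k = ((k + mInf : ℕ) : ℕ∞) := by push_cast; ring
      _ ≤ M c := hMc
  have hck' : m c < (k : ℕ∞) := by rw [hmc]; exact_mod_cast hInfk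
  obtain ⟨c', hcore, hMc', hmc'⟩ := h64 k c hck hck'
  rw [hmc] at hMc' hmc'
  exact h63 k c' hcore (le_antisymm hmc' (hmInf c')) hMc' htk hInfk

/-- **[J] Thm. 1.4 for one carrier, abstract END FORM, with Prop. 6.4 in the proved (half-core) shape**:
`depth_le_mdiv_of_coreVertices` (p471669) with `h64` weakened to levels `k > m(c)`. Every derived Heegner
point `P_c` whose conductor has all Kolyvagin indices `≥ s`, `s ≤ t = ord_p c_q`, is `p^s`-divisible.
[cite: Jetchev2008, Thm. 1.4 (p. 812) and its proof (p. 825)] -/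
theorem depth_le_mdiv_of_halfCoreVertices
    {Λ : Type*} (M mdiv m : Λ → ℕ∞) (hm : ∀ c, mdiv c < M c → m c ≤ mdiv c)
    (Core : ℕ → Λ → Prop) (t mInf : ℕ) (hmInf : ∀ c, (mInf : ℕ∞) ≤ m c)
    (hK : ∀ m' : ℕ, ∃ c, (m' : ℕ∞) ≤ M c ∧ m c = mInf)
    (h64 : ∀ (k : ℕ) (c : Λ), m c + k ≤ M c → m c < k →
      ∃ c', Core k c' ∧ (k : ℕ∞) + m c ≤ M c' ∧ m c' ≤ m c)
    (h63 : ∀ (k : ℕ) (c : Λ), Core k c → m c = mInf → (k : ℕ∞) + mInf ≤ M c →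
      t < k → mInf < k → t ≤ mInf)
    (s : ℕ) (hs : s ≤ t) (c : Λ) (hsc : (s : ℕ∞) ≤ M c) :
    (s : ℕ∞) ≤ mdiv c :=
  depth_le_mdiv_of_le_mInfty M mdiv m hm mInf hmInf
    (tamagawaExponent_le_mInfty_of_halfCoreVertices M m Core t mInf hmInf hK h64 h63) s hs c hsc

end Summit.BirchSwinnertonDyer.Rank1Residual.JET.Section6

end
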